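/-
Origin: expansion seat `planner-pub-hodgecm-pv13-g3-0`, handover #9 2026-08-18T07:36:58Z (`HOME/pub-hodgecm-pv13-g3/lean/Pv13g3/IntertwinerEnd.lean`, md5 c2801fb8, 142 lines);
landed by the gen-7 packager in gate run 26 as `HodgeCM/PerL34/IntertwinerEnd.lean` (import ^import Pv13g3\.→import HodgeCM.PerL34. ×1).
-/
/-
Copyright: HodgeCM publication cell (pub-hodgecm), DAG node N31h (seam S3) — the headline of #8 with the D4 (b)
dictionary in its PRINT SHAPE: one isometric intertwiner per split place.  Prover seat pv13-g3 (DAG-NODE PROVER #13,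
generation 3), file #9.  Released under the package licence.

# `Θ(χ′) ≠ 0` for the genuine theta lift — split places entered through ISOMETRIC INTERTWINERS

Text under adjudication (NOT cited), PerL v5 ll. 610–611: "If `v` splits in `L/L₀` then `U(W_i)(L_{0,v}) ≅ L_{0,v}^×`
acts on the Schrödinger model `𝒮(L_{0,v}^3)` of the local component of `π_f ⊗ χ_f` through the character
`y ↦ (y,y,y)` composed with the dilation action `(ω(y)φ)(x) = |y|^{3/2} φ(yx)` (up to a unitary character `[ν_v]`)".
In #4–#8 this dictionary entered as two EQUATION families on matrix coefficients (`coeff_eq` off `S`, `coeffS` with a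
constant `c_v > 0` on `S`).  Here they are replaced by the statement as print has it ([MVW]-shape, cf. pv07-g2
`DilationIntertwiner`): per split place `v` an isometric intertwiner `V_v : L²(L_{0,v}³) →ₗᵢ Sp` carrying the chosen
local vector `ψ_v` (`1_{𝒪_v³}` off `S`, `a_v • 1_D` on `S`) to `φ` and intertwining `ω ∘ ι_v` with the dilation
representation `ω^{dil}_{ν_v} ∘ t_v` on it; the equations, the constant `c_v = |a_v|²` and `0 < c_v` (from `‖φ‖ = 1`)
are DERIVED (#6 `coeff_zpow_of_intertwiner`, `coeffS_of_intertwiner`).  Complete proofs; axioms = the standard trio.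
-/
import Summits.HodgeConjecture.HodgeCM.PerL34.RallisAdic

/-! PORT of `HodgeCM/PerL34/IntertwinerEnd.lean` (HodgeCMPerL run 82) — verbatim mechanical port; provenance in the PORT header line. -/

noncomputable section

open MeasureTheory MeasureTheory.Measure Set Metric Function Complex ComplexConjugate
open scoped RestrictedProduct InnerProductSpace NNReal ENNReal

namespace HodgeCM.PerL34.SplitShells

open HodgeCM.PerL34.PureTensor HodgeCM.PerL34.AdelicFactorisation HodgeCM.PerL34.RestrictedMeasure
open HodgeCM.PerL34.NoSmallSubgroups HodgeCM.PerL34.EulerFactorisation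
open HodgeCM.PerL34.LocalFactors HodgeCM.PerL34.LocalFactors.DilationModel
open HodgeCM.PerL34.LocalModulus HodgeCM.PerL34.SplitPlaceDilation
open HodgeCM.PerL34.RallisIP HodgeCM.PerL34.Doubling HodgeCM.PerL34.N31d

attribute [local instance] LocalFactors.DilationModel.Adic.nontriviallyNormedField
  LocalFactors.DilationModel.Adic.properSpace

section intertwinerEnd

variable {ι : Type} {G : ι → Type} [∀ i, CommGroup (G i)] [∀ i, TopologicalSpace (G i)]
  [∀ i, IsTopologicalGroup (G i)] [∀ i, T2Space (G i)] [∀ i, SecondCountableTopology (G i)]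
  [∀ i, LocallyCompactSpace (G i)] [∀ i, MeasurableSpace (G i)] [∀ i, BorelSpace (G i)]
  [Countable ι] [DecidableEq ι]
  (B : ∀ i, Subgroup (G i)) (hBc : ∀ i, IsCompact (B i : Set (G i)))
  (hBo : ∀ i, IsOpen (B i : Set (G i))) (S₀ : Finset ι)
  {Sp : Type} [NormedAddCommGroup Sp] [InnerProductSpace ℂ Sp]
  {L : Type} [Field L] [StarRing L] {W : Type} [AddCommGroup W] [Module L W]
  {H Sbox : Type} [Group H] [AddCommGroup Sbox] [Module ℂ Sbox]
  {h : W →ₗ⋆[L] W →ₗ[L] L} (hW : IsLine L W) (hh : Anisotropic h)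
  (D : DoublingDatum (Πʳ j, [G j, B j]) H Sp Sbox) (GU : ThetaSide Sp Sbox)
  [Countable (unitary L)] (jA : unitary L →* Πʳ j, [G j, B j]) (hjA : Function.Injective jA)
  (j : isomBox h →* H) (hj : ∀ d : unitary L, j ⟨iotaSnd d, iotaSnd_mem h d⟩ = D.ι (1, jA d))
  {𝓕 : Set (Πʳ j, [G j, B j])} (h𝓕 : IsFundamentalDomain jA.range 𝓕 (haarDatum B hBc hBo S₀).μ)
  (χ : (Πʳ j, [G j, B j]) →* Circle) (hχΓ : ∀ d : unitary L, χ (jA d) = 1)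
  (hχVΓ : ∀ d : unitary L, D.χV (jA d) = 1)
  {hP : ∀ Ψ : Sbox, ∀ p ∈ (stabDelta L W).subgroupOf (isomBox h), ∀ x : H,
    D.fSW Ψ (j p * x) = D.fSW Ψ x}
  (P : GluePrintInputs D GU h j hP) (φ : Sp) (hφ : ‖φ‖ = 1)
  (hloc : ∀ (i : ι) (v : Sp), Continuous fun g : G i => D.ω (RestrictedProduct.mulSingle B i g) v)
  {T' : Finset ι} (hχT' : RestrictedProduct.boxSubgroup B T' ≤ χ.ker)
  (hlocχ : ∀ i ∈ T', Continuous fun g : G i => χ (RestrictedProduct.mulSingle B i g))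
  {T : Finset ι} (hK : ∀ k ∈ RestrictedProduct.boxSubgroup B T, D.ω k φ = φ)
  (hM : ∀ S : Finset ι, T ⊆ S → ∀ y : (i : ↥S) → G i,
    inner ℂ φ (D.ω (extendOne B S y) φ) = ∏ i : ↥S, localCoeff B D.ω φ i (y i))
  {S : Finset ι} {IsSplit : ι → Prop} (hTS : T ⊆ S) (hT'S : T' ⊆ S)
  (L₀ : Type) [Field L₀] [NumberField L₀]
  (w : ι → IsDedekindDomain.HeightOneSpectrum (NumberField.RingOfIntegers L₀))
  (hw : ∀ ⦃i j : ι⦄, i ∉ S → j ∉ S → w i = w j → i = j)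
  [∀ i, MeasurableSpace ((w i).adicCompletion L₀)] [∀ i, BorelSpace ((w i).adicCompletion L₀)]
  (ν : ∀ i, ((w i).adicCompletion L₀)ˣ →* Circle)
  (hBi : ∀ i, i ∉ S → ¬IsSplit i → (B i : Set (G i)) = Set.univ)
  -- `v ∉ S` split: valuation / uniformizers (D4 identification), `ν_v` unramified, and the INTERTWINER on `1_{𝒪_v³}`
  (ord : ∀ i, G i →* Multiplicative ℤ) (ϖ : ∀ i, G i) (ϖF : ∀ i, ((w i).adicCompletion L₀)ˣ)
  (hϖF : ∀ i, i ∉ S → IsUniformizer (ϖF i))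
  (ord_ϖ : ∀ i, i ∉ S → IsSplit i → ord i (ϖ i) = Multiplicative.ofAdd 1)
  (ker_ord : ∀ i, i ∉ S → IsSplit i → ∀ g : G i, ord i g = 1 ↔ g ∈ B i)
  (hν : ∀ i, i ∉ S → IsSplit i → ∀ u : ((w i).adicCompletion L₀)ˣ,
    ‖(u : (w i).adicCompletion L₀)‖ = 1 → ν i u = 1)
  (tU : ∀ i, i ∉ S → IsSplit i → (G i →* ((w i).adicCompletion L₀)ˣ))
  (htU : ∀ i (hi : i ∉ S) (hs : IsSplit i), tU i hi hs (ϖ i) = ϖF i)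
  (VU : ∀ i, i ∉ S → IsSplit i → (Lp ℂ 2 (Adic.muV L₀ (w i)) →ₗᵢ[ℂ] Sp))
  (hVUψ : ∀ i (hi : i ∉ S) (hs : IsSplit i), VU i hi hs (ballIndicator (Adic.muV L₀ (w i)) 0 1) = φ)
  (hVU : ∀ i (hi : i ∉ S) (hs : IsSplit i), ∀ g : G i,
    D.ω (RestrictedProduct.mulSingle B i g) (VU i hi hs (ballIndicator (Adic.muV L₀ (w i)) 0 1))
      = VU i hi hs (dilationRep (Adic.muV L₀ (w i)) (ν i) (tU i hi hs g) (ballIndicator (Adic.muV L₀ (w i)) 0 1)))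
  -- `v ∈ S` split: `τ_v` (D4 identification), the ball and "N large" (CHOICE), and the INTERTWINER on `a_v • 1_D`
  (τ : ∀ i, i ∈ S → IsSplit i → (G i ≃ₜ* ((w i).adicCompletion L₀)ˣ))
  (x₀ : ∀ i, Fin 3 → (w i).adicCompletion L₀) (r : ι → ℝ) (a : ι → ℂ)
  (hr : ∀ i ∈ S, IsSplit i → r i < ‖x₀ i‖) (hr0 : ∀ i ∈ S, IsSplit i → 0 < r i)
  (hνS : ∀ i ∈ S, IsSplit i → ∀ y : ((w i).adicCompletion L₀)ˣ,
    (y : (w i).adicCompletion L₀) ∈ U1 (x₀ i) (r i) → ν i y = 1)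
  (hχS : ∀ i (hi : i ∈ S) (hs : IsSplit i), ∀ g : G i,
    ((τ i hi hs g : ((w i).adicCompletion L₀)ˣ) : (w i).adicCompletion L₀) ∈ U1 (x₀ i) (r i) →
      χ (RestrictedProduct.mulSingle B i g) = 1)
  (VS : ∀ i, i ∈ S → IsSplit i → (Lp ℂ 2 (Adic.muV L₀ (w i)) →ₗᵢ[ℂ] Sp))
  (hVSψ : ∀ i (hi : i ∈ S) (hs : IsSplit i),
    VS i hi hs (a i • ballIndicator (Adic.muV L₀ (w i)) (x₀ i) (r i)) = φ)
  (hVS : ∀ i (hi : i ∈ S) (hs : IsSplit i), ∀ g : G i,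
    D.ω (RestrictedProduct.mulSingle B i g) (VS i hi hs (a i • ballIndicator (Adic.muV L₀ (w i)) (x₀ i) (r i)))
      = VS i hi hs (dilationRep (Adic.muV L₀ (w i)) (ν i) (τ i hi hs g)
          (a i • ballIndicator (Adic.muV L₀ (w i)) (x₀ i) (r i))))
  -- `v ∈ S` non-split: compact local group, isotypy of the chosen vector
  (hcpt : ∀ i ∈ S, ¬IsSplit i → CompactSpace (G i))
  (hiso : ∀ i ∈ S, ¬IsSplit i → ∀ g : G i, D.ω (RestrictedProduct.mulSingle B i g) φ
    = conj (((χ (RestrictedProduct.mulSingle B i g) : Circle) : ℂ)) • φ)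

include hφ hVSψ in
omit [Countable ι] [DecidableEq ι] in
/-- The scalar of the chosen local vector `a_v • 1_D` is non-zero (`‖φ‖ = 1`), so `c_v := |a_v|² > 0`. -/
theorem normSq_pos_of_intertwiner {i : ι} (hi : i ∈ S) (hs : IsSplit i) : 0 < ‖a i‖ ^ 2 := by
  have hne : a i ≠ 0 := by
    intro h0
    have hφ0 : φ = 0 := by rw [← hVSψ i hi hs, h0, zero_smul, map_zero]
    simp [hφ0] at hφ
  positivity

include hW hh hjA hj h𝓕 hχΓ hχVΓ P hφ hloc hχT' hlocχ hK hM hTS hT'S hw hBi hϖF ord_ϖ ker_ord hν htU hVUψ hVU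
  hr hr0 hνS hχS hVSψ hVS hcpt hiso

/-- **Lemma 4.2(b)'s conclusion `Θ(χ′) ≠ 0` for the genuine theta lift — split places through ISOMETRIC
INTERTWINERS.**  #8 `thetaLift_ne_zero_of_N31d_adic` with its dictionary EQUATIONS `coeff_eq` (off `S`),
`coeffS`/`cS`/`hcS` (on `S`) DERIVED from one isometric intertwiner per split place (tex ll. 610–611 as printed). -/
theorem thetaLift_ne_zero_of_N31d_intertwiner [IsFiniteMeasure GU.μ]
    [IsFiniteMeasure (((haarDatum B hBc hBo S₀).μ).restrict 𝓕)]
    (hk : Measurable (Function.uncurry (thetaFn D GU φ))) {Ck : ℝ} (hCk : 0 ≤ Ck)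
    (hkC : ∀ q u, ‖thetaFn D GU φ q u‖ ≤ Ck) :
    PeterssonFubini.theta GU.μ (((haarDatum B hBc hBo S₀).μ).restrict 𝓕) hk
      (measurable_coe_char B hBo χ hχT' hlocχ) hCk hkC (norm_coe_char_le χ) ≠ 0 := by
  classical
  exact thetaLift_ne_zero_of_N31d_adic B hBc hBo S₀ hW hh D GU jA hjA j hj h𝓕 χ hχΓ hχVΓ P φ hφ hloc hχT'
    hlocχ hK hM hTS hT'S L₀ w hw ν hBi ord ϖ ϖF hϖF ord_ϖ ker_ord hν
    (fun i hi hs n => coeff_zpow_of_intertwiner B D.ω φ (Adic.muV L₀ (w i)) (ν i) i (tU i hi hs) (ϖ i)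
      (ϖF i) (htU i hi hs) 1 (VU i hi hs) (hVUψ i hi hs) (hVU i hi hs) n)
    τ x₀ r (fun i => ‖a i‖ ^ 2) hr hr0
    (fun i hi hs => normSq_pos_of_intertwiner φ hφ L₀ w x₀ r a VS hVSψ hi hs) hνS hχS
    (fun i hi hs g => coeffS_of_intertwiner B D.ω φ (Adic.muV L₀ (w i)) (ν i) i (fun g => τ i hi hs g)
      (x₀ i) (r i) (a i) (VS i hi hs) (hVSψ i hi hs) (hVS i hi hs) g)
    hcpt hiso hk hCk hkC

end intertwinerEnd

end HodgeCM.PerL34.SplitShells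

end
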